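import Summits.QuantumFields.BalabanUV.T4Continuum.Support.RegularBackgroundTowerSharp
import Summits.QuantumFields.BalabanUV.T4Continuum.Support.CovariantLaplacianRate

/-!
# T⁴ programme, spine node NE2 (U1a), tier B row B8 «general rate» (owner rulings R17 (c) / R19), PART 4a — THE SHARP B2/B5 FACE AT A GENERAL
# GEOMETRIC RATE `θ ∈ [L⁻¹, 1)`: the covariant-Laplacian summand's `PerturbationLaws` with the relative bound `κ = kappaCol o d a α β (d(α²+2β))`
# of the REGULARITY CLASS ONLY (node NE3's constant in `C₂` only), node NE3's input allowed at rate `θ`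

NE2 formalisation swarm `b2b-balaban-t4-ne2-formalise-*`, leaf prover 08 (gen 2; rows B7 / B6′ / B8-part-2 lineage; INTENT CLAIMS.log 2026-08-20,
part 4 holder by owner ruling R19 (c)).  WHY THIS FILE: R19 (c) fixes the general-rate END's threshold as the SAME `NE2BalabanThreshold.etaStar`, which is
built on `NE2BalabanLayerSharp.{kappaBs, KstarR}` — i.e. on leaf-03's SHARP face `RegularBackgroundTowerSharp.perturbationLaws_covariantLaplacian_of_
regular_sharp` (`κ = kappaCol o d a α β (d(α²+2β))`, NE3's `C` only in `C2colSplit`).  Part 1 (leaf-07-g3, `CovariantLaplacianRate`) re-typed the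
NON-sharp face (`κ = kappaCol o d a α (max β βNE3) …`) at rate `θ`; THIS FILE re-types the sharp one, re-using part 1's rate-θ STRUCTURES and read-outs
BY NAME (`LipschitzBackgroundMRate`/`BoundedBackgroundMRate`, `boundedBackgroundRate_entry`, `matrixBoundsRate_of_regular_of_localRate`,
`FirstOrderModelRate.{perturbationLaws_zerothOrder_rate, invPow_le_pow, rate_nonneg, div_lev_eq_mul_invPow}`) and declaring NO structure (R19 (b)(ii)).

WHAT THIS FILE PROVES (bookkeeping; no new estimate — the landed two-level estimates `FirstOrderBackgroundModel.opNorm_consistency_le` /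
`FirstOrderAdjointModel.opNorm_adjoint_consistency_le` carry a FREE defect `δ`, here `δ = βc·θ^k`, packaged exactly as in part 1):
 * §1 `perturbationLaws_firstOrder_split_rate`, `perturbationLaws_firstOrderAdjoint_split_rate` — leaf-03's split scalar laws (`κ = d(α + β_lip)Cst`,
   `C₂ = C2model d L a α β_cons` / `C2adjSplit d L a α β_lip β_cons`) with the two-level consistency hypothesis `≤ β_cons·θ^k`, `L⁻¹ ≤ θ`;
 * §2 `perturbationLaws_colourCovariantLaplacian_split_rate` — the matrix-unit reduction verbatim (`κ = kappaCol o d a α β_lip α′`,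
   `C₂ = C2colSplit o d L a α β_lip β_cons β′`, majorant `·θ^k`), zeroth order through part 1's `perturbationLaws_zerothOrder_rate`;
 * §3 the END **`perturbationLaws_covariantLaplacian_of_regular_sharp_rate (hd) (hreg) (hC) (hθ : L⁻¹ ≤ θ) (hNE3θ : LocalRate (bgReadings (regClass R))
   C θ) : PerturbationLaws (Δ_a ⊗ 1) (covPertC R) (J ⊗ 1) (kappaCol o d a α β (d(α²+2β)))
   (k ↦ C2colSplit o d L a α β (βNE3 C) (d(2α(βNE3+β)+2βNE3))·θ^k)`**
   — EVERY LETTER of the sharp face of record, the rate alone moved — and `covariantLaplacian_rate_of_regular_sharp_rate (hθ) (hθ1 : θ < 1) (hsmall :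
   kappaCol … < 1) : TowerLimitRate … θ` through the owner's `NE2ColourPerturbedLayerRate.towerLimitRate_perturbed_king_kron_rate`;
   a kernel `example` records that at `θ = L⁻¹` the END IS leaf-03's (re-derived from it by `exact`; TYPE identity).

HONEST FRAMING (T4-DAG p. 1).  MODEL LEVEL (transporters DATA; GLOBAL small field; no dictionary B0, c5); node NE3's `LocalRate` DISPLAYED and consumed
BY NAME (c2/c7) — nothing of NE3 is proved; the instance of record (`θ = L⁻¹`) neither edited nor superseded; finite torus, operator norm; constants
OURS; **NE2 (U1a) NOT PROVED**; spine PROVED 0/9 unchanged; NOT infinite volume, NOT a mass gap, NOT Clay.  HONEST DEPENDENCY: continuum YM on T⁴ ⇐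
BetaPertH ∧ nine spine estimates (0/9 proved); BetaPertH ⇐ (D1) ∧ (D4) ∧ CAP+tail; G-an2-4 gates asym, D1 and NE2/3/4.  ABSOLUTE RULE kept; no
`def … : Prop` fact; no new definition; no `sorry`.
-/

noncomputable section

open scoped BigOperators ComplexConjugate Matrix Matrix.Norms.L2Operator Kronecker

namespace Summit.QuantumFields.BalabanUV.T4Continuum.CovariantLaplacianSharpRate

open Literature.MathematicalPhysics.QuantumFieldTheory.Balaban1983to89.B5Prop11Plancherel
open Literature.MathematicalPhysics.QuantumFieldTheory.Balaban1983to89.B5G183RateUnitTower (lev lev_neZero)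
open Literature.MathematicalPhysics.QuantumFieldTheory.Balaban1983to89.T4EtaRateMin (LocalRate)
open Summit.QuantumFields.BalabanUV.T4Continuum
open Summit.QuantumFields.BalabanUV.T4Continuum.CovariantAveragingTower (TowerLimitRate)
open Summit.QuantumFields.BalabanUV.T4Continuum.BalabanAveragedTowerUnit (idx Qlev calGlev one_le_lev' cast_lev')
open Summit.QuantumFields.BalabanUV.T4Continuum.BackgroundResolventTower
open Summit.QuantumFields.BalabanUV.T4Continuum.KingPairingPlantedLaw
open Summit.QuantumFields.BalabanUV.T4Continuum.BlockPairingGeometry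
open Summit.QuantumFields.BalabanUV.T4Continuum.NE2PerturbedLayer
open Summit.QuantumFields.BalabanUV.T4Continuum.FirstOrderBackgroundModel
open Summit.QuantumFields.BalabanUV.T4Continuum.PerturbationAlgebra
open Summit.QuantumFields.BalabanUV.T4Continuum.FirstOrderAdjointModel
open Summit.QuantumFields.BalabanUV.T4Continuum.KroneckerLift
open Summit.QuantumFields.BalabanUV.T4Continuum.KroneckerUnits
open Summit.QuantumFields.BalabanUV.T4Continuum.ColourCovariantLaplacian
open Summit.QuantumFields.BalabanUV.T4Continuum.NE2FromNE3 (bgReadings consistent_of_localRate)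
open Summit.QuantumFields.BalabanUV.T4Continuum.RegularBackgroundTower
open Summit.QuantumFields.BalabanUV.T4Continuum.RegularBackgroundTowerSharp (C2adjSplit C2colSplit perturbationLaws_firstOrder_split
  perturbationLaws_firstOrderAdjoint_split perturbationLaws_covariantLaplacian_of_regular_sharp)
open Summit.QuantumFields.BalabanUV.T4Continuum.NE2ColourPerturbedLayerRate (towerLimitRate_perturbed_king_kron_rate)
open Summit.QuantumFields.BalabanUV.T4Continuum.FirstOrderModelRate
open Summit.QuantumFields.BalabanUV.T4Continuum.CovariantLaplacianRate (LipschitzBackgroundMRate BoundedBackgroundMRate boundedBackgroundRate_entry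
  matrixBoundsRate_of_regular_of_localRate)

variable {d : ℕ} (L : ℕ) [NeZero L] (M : Fin d → ℕ) [hM : ∀ μ, NeZero (M μ)] (a : ℝ) (ha : 0 < a)

/-! ## §1 The scalar first-order laws with split constants at rate `θ` -/

/-- **`PerturbationLaws` FOR THE FIRST-ORDER MODEL, SPLIT CONSTANTS, RATE `θ`** (`d ≥ 1`, `L⁻¹ ≤ θ`): size `α`, lattice-Lipschitz `β_lip/n_k`,
two-level consistency `β_cons·θ^k` give `κ = d(α + β_lip)Cst` and `e₂ k = C2model d L a α β_cons·θ^k` — leaf-03's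
`perturbationLaws_firstOrder_split`
with the consistency re-typed, `consistent_le` packaged as in part 1's `perturbationLaws_firstOrder_rate` (the complement term `(2dCst/n_k)(L+1)αCst`
majorised by `·θ^k`). [cite: Balaban1984PropagatorsI, Prop. 1.1 (1.89) p.33; King1986, (2.10) p.653] [folklore] -/
theorem perturbationLaws_firstOrder_split_rate (hd : 1 ≤ d) {V : (k : ℕ) → Fin d → (idx L M k → ℂ)} {α βl βc θ : ℝ}
    (hθ : ((L : ℝ)⁻¹) ≤ θ) (hα : 0 ≤ α) (hβl : 0 ≤ βl) (hβc : 0 ≤ βc) (hb : ∀ k μ (i : idx L M k), ‖V k μ i‖ ≤ α)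
    (hl : ∀ k μ ν (i : idx L M k), ‖V k μ (tau (fine (lev L k) M) ν i) - V k μ i‖ ≤ βl / (lev L k : ℕ))
    (hc : ∀ k μ (i : idx L M (k + 1)), ‖V (k + 1) μ i - V k μ (parT (lev L k) L M i)‖ ≤ βc * θ ^ k) :
    PerturbationLaws (calDalev L M a ha) (Pmodel L M V) (JpcT L M) (d * (α + βl) * Cst d a)
      (fun k => C2model d L a α βc * θ ^ k) where
  opNorm_P_mul_inv_le := fun k => by
    rw [calDalev_inv]
    have h := opNorm_firstOrder_mul_calG_le (lev L k) (one_le_lev' L k) M a ha hα (hb k)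
    refine h.trans ?_
    exact mul_le_mul_of_nonneg_right (mul_le_mul_of_nonneg_left (le_add_of_nonneg_right hβl) (Nat.cast_nonneg d))
      (Cst_nonneg d a)
  opNorm_inv_mul_P_le := fun k => by
    rw [calDalev_inv]
    exact opNorm_calG_mul_firstOrder_le (lev L k) (one_le_lev' L k) M a ha hα hβl (hb k) (fun μ i => hl k μ μ i)
  consistent_le := fun k => by
    have hC := Cst_nonneg d a
    have hθ0 := rate_nonneg L hθ
    have hδ : 0 ≤ βc * θ ^ k := mul_nonneg hβc (pow_nonneg hθ0 k)
    rw [calDalev_inv, calDalev_inv]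
    have h := opNorm_consistency_le (lev L k) L M a ha hd (one_le_lev' L k) (one_le_lev' L (k + 1)) hα hδ (hb k) (hc k)
    refine h.trans ?_
    have hpow := invPow_le_pow L hθ k
    calc (d : ℝ) * (L * Cst d a * (βc * θ ^ k) * Cst d a + 2 * d * Cst d a / (lev L k : ℕ) * (L + 1) * α * Cst d a)
        = d * (L * Cst d a * βc * Cst d a) * θ ^ k
          + d * (2 * d * Cst d a * (L + 1) * α * Cst d a) * ((L : ℝ)⁻¹) ^ k := by
          rw [div_lev_eq_mul_invPow L]; ring
      _ ≤ d * (L * Cst d a * βc * Cst d a) * θ ^ k + d * (2 * d * Cst d a * (L + 1) * α * Cst d a) * θ ^ k := by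
          have hY : (0 : ℝ) ≤ d * (2 * d * Cst d a * (L + 1) * α * Cst d a) := by positivity
          exact add_le_add le_rfl (mul_le_mul_of_nonneg_left hpow hY)
      _ = C2model d L a α βc * θ ^ k := by rw [C2model]; ring

/-- **`PerturbationLaws` FOR THE ADJOINT FAMILY, SPLIT CONSTANTS, RATE `θ`** (`d ≥ 1`, `L⁻¹ ≤ θ`): `κ = d(α + β_lip)Cst`,
`e₂ k = C2adjSplit d L a α β_lip β_cons·θ^k`. [cite: Balaban1984PropagatorsI, Prop. 1.1 (1.89) p.33; King1986, (2.10) p.653] [folklore] -/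
theorem perturbationLaws_firstOrderAdjoint_split_rate (hd : 1 ≤ d) {V : (k : ℕ) → Fin d → (idx L M k → ℂ)} {α βl βc θ : ℝ}
    (hθ : ((L : ℝ)⁻¹) ≤ θ) (hα : 0 ≤ α) (hβl : 0 ≤ βl) (hβc : 0 ≤ βc) (hb : ∀ k μ (i : idx L M k), ‖V k μ i‖ ≤ α)
    (hl : ∀ k μ ν (i : idx L M k), ‖V k μ (tau (fine (lev L k) M) ν i) - V k μ i‖ ≤ βl / (lev L k : ℕ))
    (hc : ∀ k μ (i : idx L M (k + 1)), ‖V (k + 1) μ i - V k μ (parT (lev L k) L M i)‖ ≤ βc * θ ^ k) :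
    PerturbationLaws (calDalev L M a ha) (fun k => (Pmodel L M V k)ᴴ) (JpcT L M) (d * (α + βl) * Cst d a)
      (fun k => C2adjSplit d L a α βl βc * θ ^ k) where
  opNorm_P_mul_inv_le := fun k => by
    have e : (Pmodel L M V k)ᴴ * (calDalev L M a ha k)⁻¹ = ((calDalev L M a ha k)⁻¹ * Pmodel L M V k)ᴴ := by
      rw [Matrix.conjTranspose_mul, conjTranspose_inv_calDalev]
    rw [e, Matrix.l2_opNorm_conjTranspose]
    exact (perturbationLaws_firstOrder_split_rate L M a ha hd hθ hα hβl hβc hb hl hc).opNorm_inv_mul_P_le k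
  opNorm_inv_mul_P_le := fun k => by
    have e : (calDalev L M a ha k)⁻¹ * (Pmodel L M V k)ᴴ = (Pmodel L M V k * (calDalev L M a ha k)⁻¹)ᴴ := by
      rw [Matrix.conjTranspose_mul, conjTranspose_inv_calDalev]
    rw [e, Matrix.l2_opNorm_conjTranspose]
    exact (perturbationLaws_firstOrder_split_rate L M a ha hd hθ hα hβl hβc hb hl hc).opNorm_P_mul_inv_le k
  consistent_le := fun k => by
    have hC := Cst_nonneg d a
    have hθ0 := rate_nonneg L hθ
    have hδ : 0 ≤ βc * θ ^ k := mul_nonneg hβc (pow_nonneg hθ0 k)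
    change ‖(calDalev L M a ha (k + 1))⁻¹ * ((Pmodel L M V (k + 1))ᴴ * JpcT L M k - JpcT L M k * (Pmodel L M V k)ᴴ)
        * (calDalev L M a ha k)⁻¹‖ ≤ _
    rw [calDalev_inv, calDalev_inv]
    have h := opNorm_adjoint_consistency_le (lev L k) L M a ha hd (one_le_lev' L k) (one_le_lev' L (k + 1)) hα hβl hδ (hb k)
      (fun μ i => hl k μ μ i) (hc k)
    refine h.trans ?_
    have hpow := invPow_le_pow L hθ k
    calc (d : ℝ) * (Cst d a * (βc * θ ^ k) * Cst d a + 2 * d * Cst d a / (lev L k : ℕ) * (L + 1) * ((α + βl) * Cst d a))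
        = d * (Cst d a * βc * Cst d a) * θ ^ k
          + d * (2 * d * Cst d a * (L + 1) * ((α + βl) * Cst d a)) * ((L : ℝ)⁻¹) ^ k := by
          rw [div_lev_eq_mul_invPow L]; ring
      _ ≤ d * (Cst d a * βc * Cst d a) * θ ^ k + d * (2 * d * Cst d a * (L + 1) * ((α + βl) * Cst d a)) * θ ^ k := by
          have hY : (0 : ℝ) ≤ d * (2 * d * Cst d a * (L + 1) * ((α + βl) * Cst d a)) := by positivity
          exact add_le_add le_rfl (mul_le_mul_of_nonneg_left hpow hY)
      _ = C2adjSplit d L a α βl βc * θ ^ k := by rw [C2adjSplit]; ring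

/-! ## §2 The colour covariant Laplacian with split constants at rate `θ` -/

variable {o : Type*} [Fintype o] [DecidableEq o]

/-- **`PerturbationLaws` FOR THE NON-ABELIAN COVARIANT LAPLACIAN, SPLIT CONSTANTS, RATE `θ`** (`d ≥ 1`, `L⁻¹ ≤ θ`): matrix-level size `α`,
lattice-Lipschitz `β_lip/n_k` and two-level consistency `β_cons·θ^k` of the connection `−w`, plus a `BoundedBackgroundMRate (α′, β′, θ)`
zeroth-order field, give the target shape for `covPertC L M R` with `κ = kappaCol o d a α β_lip α′` — INDEPENDENT of `β_cons` — and
`C₂ = C2colSplit·θ^k`.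
Leaf-03's matrix-unit reduction verbatim over §1 and part 1's `perturbationLaws_zerothOrder_rate`. [folklore] -/
theorem perturbationLaws_colourCovariantLaplacian_split_rate (hd : 1 ≤ d) {R : (k : ℕ) → Fin d → (idx L M k → Matrix o o ℂ)}
    {α βl βc α' β' θ : ℝ} (hθ : ((L : ℝ)⁻¹) ≤ θ) (hα : 0 ≤ α) (hβl : 0 ≤ βl) (hβc : 0 ≤ βc)
    (hb : ∀ k ν (i : idx L M k), ‖negConnM (fine (lev L k) M) ((lev L k : ℕ) : ℂ) (R k) ν i‖ ≤ α)
    (hl : ∀ k ν μ (i : idx L M k), ‖negConnM (fine (lev L k) M) ((lev L k : ℕ) : ℂ) (R k) ν (tau (fine (lev L k) M) μ i)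
      - negConnM (fine (lev L k) M) ((lev L k : ℕ) : ℂ) (R k) ν i‖ ≤ βl / (lev L k : ℕ))
    (hc : ∀ k ν (i : idx L M (k + 1)), ‖negConnM (fine (lev L (k + 1)) M) ((lev L (k + 1) : ℕ) : ℂ) (R (k + 1)) ν i
      - negConnM (fine (lev L k) M) ((lev L k : ℕ) : ℂ) (R k) ν (parT (lev L k) L M i)‖ ≤ βc * θ ^ k)
    (hz : BoundedBackgroundMRate L M (fun k i => zfieldC (fine (lev L k) M) ((lev L k : ℕ) : ℂ) (R k) i) α' β' θ) :
    PerturbationLaws (fun k => calDalev L M a ha k ⊗ₖ (1 : Matrix o o ℂ)) (covPertC L M R)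
      (fun k => JpcT L M k ⊗ₖ (1 : Matrix o o ℂ)) (kappaCol o d a α βl α') (fun k => C2colSplit o d L a α βl βc β' * θ ^ k) := by
  have hθ0 := rate_nonneg L hθ
  -- entrywise hypotheses for the scalar towers `Vab R p`
  have hbp : ∀ (p : o × o) k μ (i : idx L M k), ‖Vab L M R p k μ i‖ ≤ α := fun p k μ i =>
    (norm_entry_le _ p.1 p.2).trans (hb k μ i)
  have hlp : ∀ (p : o × o) k μ ν (i : idx L M k),
      ‖Vab L M R p k μ (tau (fine (lev L k) M) ν i) - Vab L M R p k μ i‖ ≤ βl / (lev L k : ℕ) := fun p k μ ν i => by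
    show ‖negConnM (fine (lev L k) M) ((lev L k : ℕ) : ℂ) (R k) μ (tau (fine (lev L k) M) ν i) p.1 p.2
        - negConnM (fine (lev L k) M) ((lev L k : ℕ) : ℂ) (R k) μ i p.1 p.2‖ ≤ βl / (lev L k : ℕ)
    rw [← Matrix.sub_apply]; exact (norm_entry_le _ p.1 p.2).trans (hl k μ ν i)
  have hcp : ∀ (p : o × o) k μ (i : idx L M (k + 1)),
      ‖Vab L M R p (k + 1) μ i - Vab L M R p k μ (parT (lev L k) L M i)‖ ≤ βc * θ ^ k := fun p k μ i => by
    show ‖negConnM (fine (lev L (k + 1)) M) ((lev L (k + 1) : ℕ) : ℂ) (R (k + 1)) μ i p.1 p.2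
        - negConnM (fine (lev L k) M) ((lev L k : ℕ) : ℂ) (R k) μ (parT (lev L k) L M i) p.1 p.2‖ ≤ βc * θ ^ k
    rw [← Matrix.sub_apply]; exact (norm_entry_le _ p.1 p.2).trans (hc k μ i)
  have hF : PerturbationLaws (fun k => calDalev L M a ha k ⊗ₖ (1 : Matrix o o ℂ)) (fun k => ∑ p : o × o, pieceF L M R p k)
      (fun k => JpcT L M k ⊗ₖ (1 : Matrix o o ℂ)) (∑ _p : o × o, d * (α + βl) * Cst d a)
      (fun k => ∑ _p : o × o, C2model d L a α βc * θ ^ k) :=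
    perturbationLaws_finsetSum _ fun p _ =>
      perturbationLaws_kronUnit (perturbationLaws_firstOrder_split_rate L M a ha hd hθ hα hβl hβc (hbp p) (hlp p) (hcp p)) p.1 p.2
  have hA : PerturbationLaws (fun k => calDalev L M a ha k ⊗ₖ (1 : Matrix o o ℂ)) (fun k => ∑ p : o × o, pieceA L M R p k)
      (fun k => JpcT L M k ⊗ₖ (1 : Matrix o o ℂ)) (∑ _p : o × o, d * (α + βl) * Cst d a)
      (fun k => ∑ _p : o × o, C2adjSplit d L a α βl βc * θ ^ k) :=
    perturbationLaws_finsetSum _ fun p _ =>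
      perturbationLaws_kronUnit (perturbationLaws_firstOrderAdjoint_split_rate L M a ha hd hθ hα hβl hβc (hbp p) (hlp p) (hcp p)) p.2 p.1
  have hZ : PerturbationLaws (fun k => calDalev L M a ha k ⊗ₖ (1 : Matrix o o ℂ)) (fun k => ∑ p : o × o, pieceZ L M R p k)
      (fun k => JpcT L M k ⊗ₖ (1 : Matrix o o ℂ)) (∑ _p : o × o, α' * Cst d a)
      (fun k => ∑ _p : o × o, Cst d a * β' * Cst d a * θ ^ k) :=
    perturbationLaws_finsetSum _ fun p _ =>
      perturbationLaws_kronUnit (perturbationLaws_zerothOrder_rate L M a ha hθ0 (boundedBackgroundRate_entry L M hz p)) p.1 p.2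
  have h := perturbationLaws_add (perturbationLaws_add hF hA) hZ
  have e : covPertC L M R = fun k => (∑ p : o × o, pieceF L M R p k) + (∑ p : o × o, pieceA L M R p k) + ∑ p : o × o, pieceZ L M R p k :=
    funext fun k => covPertC_eq L M R k
  rw [e]
  refine perturbationLaws_mono h (le_of_eq ?_) fun k => le_of_eq ?_
  · simp only [Finset.sum_const, Finset.card_univ, Fintype.card_prod, kappaCol]; ring
  · simp only [Finset.sum_const, Finset.card_univ, Fintype.card_prod, C2colSplit]; ring

/-! ## §3 Row B5's sharp END at rate `θ` -/

/-- **THE COVARIANT-LAPLACIAN SUMMAND's `PerturbationLaws` FROM THE REGULARITY CLASS AND NODE NE3 AT RATE `θ`, SHARP THRESHOLD** (`d ≥ 1`,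
`L⁻¹ ≤ θ`): `κ = kappaCol o d a α β (d(α² + 2β))` depends on the regularity class `(α, β)` ONLY; NE3's rate constant `C` (`βNE3 = 2·card o·C`)
enters `C₂ = C2colSplit o d L a α β βNE3 (d(2α(βNE3 + β) + 2βNE3))` only — EVERY LETTER of leaf-03's
`perturbationLaws_covariantLaplacian_of_regular_sharp`,
the majorant alone re-typed `·θ^k`.  The consistencies of `w` and `z` are READ OFF node NE3's `LocalRate … C θ` by row B6's GENERAL
`NE2FromNE3.consistent_of_localRate` and part 1's `matrixBoundsRate_of_regular_of_localRate`.  Binders `hreg`, `hNE3θ` DISPLAYED; NE2 is NOT proved by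
this. [folklore] -/
theorem perturbationLaws_covariantLaplacian_of_regular_sharp_rate (hd : 1 ≤ d) {R : (k : ℕ) → Fin d → (idx L M k → Matrix o o ℂ)}
    {α β : ℝ} (hreg : RegularTransporters L M R α β) {C θ : ℝ} (hC : 0 ≤ C) (hθ : ((L : ℝ)⁻¹) ≤ θ)
    (hNE3θ : LocalRate (bgReadings L M (regClass L M R)) C θ) :
    PerturbationLaws (fun k => calDalev L M a ha k ⊗ₖ (1 : Matrix o o ℂ)) (covPertC L M R)
      (fun k => JpcT L M k ⊗ₖ (1 : Matrix o o ℂ)) (kappaCol o d a α β (d * (α ^ 2 + 2 * β)))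
      (fun k => C2colSplit o d L a α β (betaNE3 o C) (d * (2 * α * (betaNE3 o C + β) + 2 * betaNE3 o C)) * θ ^ k) := by
  obtain ⟨hα, hβ⟩ := hreg.nonneg
  have hθ0 := rate_nonneg L hθ
  have hb3 : 0 ≤ betaNE3 o C := by unfold betaNE3; positivity
  have hw' := consistent_of_localRate L M hC hθ0 hNE3θ (Set.mem_insert _ _ : connTower L M R ∈ regClass L M R)
  have hw : ∀ k ν (i : idx L M (k + 1)),
      ‖connTower L M R (k + 1) ν i - connTower L M R k ν (parT (lev L k) L M i)‖ ≤ betaNE3 o C * θ ^ k := fun k ν i =>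
    (hw' k ν i).trans (le_of_eq (by unfold betaNE3; ring))
  refine perturbationLaws_colourCovariantLaplacian_split_rate L M a ha hd hθ hα hβ hb3 (fun k ν i => ?_) (fun k ν μ i => ?_)
    (fun k ν i => ?_) (matrixBoundsRate_of_regular_of_localRate hreg hC hθ hNE3θ).2
  · rw [negConnM_eq_neg, norm_neg]; exact norm_connTower_le hreg k ν i
  · rw [negConnM_eq_neg, negConnM_eq_neg, neg_sub_neg, norm_sub_rev]; exact connTower_lipschitz hreg k ν μ i
  · rw [negConnM_eq_neg, negConnM_eq_neg, neg_sub_neg, norm_sub_rev]; exact hw k ν i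

/-- **THE INSTANCE OF RECORD IS THE CASE `θ = L⁻¹`** (kernel `example`, not a declaration — the gate's `dedup.landed` confirms the TYPE is leaf-03's
`perturbationLaws_covariantLaplacian_of_regular_sharp` verbatim): the sharp face of record re-derived from the rate-θ END at `θ = L⁻¹` by `exact`;
the record is neither edited nor superseded. [folklore] -/
example (hd : 1 ≤ d) {R : (k : ℕ) → Fin d → (idx L M k → Matrix o o ℂ)}
    {α β : ℝ} (hreg : RegularTransporters L M R α β) {C : ℝ} (hC : 0 ≤ C)
    (hNE3 : LocalRate (bgReadings L M (regClass L M R)) C ((L : ℝ)⁻¹)) :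
    PerturbationLaws (fun k => calDalev L M a ha k ⊗ₖ (1 : Matrix o o ℂ)) (covPertC L M R)
      (fun k => JpcT L M k ⊗ₖ (1 : Matrix o o ℂ)) (kappaCol o d a α β (d * (α ^ 2 + 2 * β)))
      (fun k => C2colSplit o d L a α β (betaNE3 o C) (d * (2 * α * (betaNE3 o C + β) + 2 * betaNE3 o C)) * ((L : ℝ)⁻¹) ^ k) :=
  perturbationLaws_covariantLaplacian_of_regular_sharp_rate L M a ha hd hreg hC le_rfl hNE3

/-- **THE η-RATE FOR EVERY COUPLING `‖t‖κ < 1` WITH THE SHARP `κ`, AT RATE `θ`** (`d ≥ 1`, `L⁻¹ ≤ θ < 1` — which implies the twin's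
`2 ≤ L`): the owner's general-rate colour engine on §3's law. [folklore] -/
theorem towerLimitRate_covariantLaplacian_of_regular_sharp_rate (hd : 1 ≤ d)
    {R : (k : ℕ) → Fin d → (idx L M k → Matrix o o ℂ)} {α β : ℝ} (hreg : RegularTransporters L M R α β) {C θ : ℝ} (hC : 0 ≤ C)
    (hθ : ((L : ℝ)⁻¹) ≤ θ) (hθ1 : θ < 1) (hNE3θ : LocalRate (bgReadings L M (regClass L M R)) C θ) {t : ℂ}
    (ht : ‖t‖ * kappaCol o d a α β (d * (α ^ 2 + 2 * β)) < 1) :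
    TowerLimitRate (fun k => Qlev L M k ⊗ₖ (1 : Matrix o o ℂ)) ((L : ℝ) ^ d)
      (fun k => (calDalev L M a ha k ⊗ₖ (1 : Matrix o o ℂ) + t • covPertC L M R k)⁻¹)
      (Cpert (kappaCol o d a α β (d * (α ^ 2 + 2 * β))) (2 * d * Cst d a) (CJ d a)
        (C2colSplit o d L a α β (betaNE3 o C) (d * (2 * α * (betaNE3 o C + β) + 2 * betaNE3 o C))) 0 t) θ :=
  towerLimitRate_perturbed_king_kron_rate L M a ha hθ hθ1
    (perturbationLaws_covariantLaplacian_of_regular_sharp_rate L M a ha hd hreg hC hθ hNE3θ) ht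

/-- **THE η-RATE AT THE PHYSICAL COUPLING `t = 1` UNDER A THRESHOLD ON THE REGULARITY CLASS ALONE, AT RATE `θ`** (`d ≥ 1`, `L⁻¹ ≤ θ < 1`): if
`kappaCol o d a α β (d(α² + 2β)) < 1` — free of NE3's constant — the lifted King-averaged unit-lattice covariances of
`(Δ_a^{(k)} ⊗ 1 + Δ^{R_k} − Δ^1 ⊗ 1)⁻¹` converge with rate `θ^k`, CONDITIONAL on `hNE3θ` (displayed) for the value of `C₂`.  Leaf-03's
`covariantLaplacian_rate_of_regular_sharp` is the case
`θ = L⁻¹`.  NE2 is NOT proved by this. [folklore] -/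
theorem covariantLaplacian_rate_of_regular_sharp_rate (hd : 1 ≤ d) {R : (k : ℕ) → Fin d → (idx L M k → Matrix o o ℂ)}
    {α β : ℝ} (hreg : RegularTransporters L M R α β) {C θ : ℝ} (hC : 0 ≤ C) (hθ : ((L : ℝ)⁻¹) ≤ θ) (hθ1 : θ < 1)
    (hNE3θ : LocalRate (bgReadings L M (regClass L M R)) C θ) (hsmall : kappaCol o d a α β (d * (α ^ 2 + 2 * β)) < 1) :
    TowerLimitRate (fun k => Qlev L M k ⊗ₖ (1 : Matrix o o ℂ)) ((L : ℝ) ^ d)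
      (fun k => (calDalev L M a ha k ⊗ₖ (1 : Matrix o o ℂ) + covPertC L M R k)⁻¹)
      (Cpert (kappaCol o d a α β (d * (α ^ 2 + 2 * β))) (2 * d * Cst d a) (CJ d a)
        (C2colSplit o d L a α β (betaNE3 o C) (d * (2 * α * (betaNE3 o C + β) + 2 * betaNE3 o C))) 0 1) θ := by
  have h := towerLimitRate_covariantLaplacian_of_regular_sharp_rate L M a ha hd hreg hC hθ hθ1 hNE3θ (t := 1) (by rwa [norm_one, one_mul])
  simpa only [one_smul] using h

end Summit.QuantumFields.BalabanUV.T4Continuum.CovariantLaplacianSharpRate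

end
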